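import Literature.IUT.HodgeArakelov.CohomologyLimitComapAct
import Literature.IUT.HodgeArakelov.BadPrimeGaussianMonoidsGenuineRecordInftyProofs
import Literature.IUT.HodgeArakelov.BadPrimeGaussianMonoidsGenuineRecordGaloisFamily

/-!
# [IUTchII] Cor 3.5 (ii) «⥤» (Galois clause), the `∞`-level and Rmk 3.6.1 with the labelled copies identified through
# EQUALITY OF COEFFICIENT ACTIONS — label-wise Kummer-hom model AND the genuine `θ_env` data, any inversion family
# (repair of GAP-LEDGER G-w4d004-1, part 4; proof-only)

S. Mochizuki, *Inter-universal Teichmüller theory II*, kurims Dec-2020 manuscript, Cor 3.5 (i)/(ii) pp. 94–95 ("each of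
`∞Ψ_ξ(M^Θ_*)`, `Ψ_ξ(M^Θ_*)` is equipped with a natural action by `G_v(M^Θ_*▶)_{⟨F_l^⋇⟩}`", «the inclusions
`G_v(M^Θ_*) ↪ Π_{v▶}(M^Θ_*▶)` determined by the various choices of the `D^δ_{t,μ_-}`»), Rmk 3.6.1 p. 101
[cite: Mochizuki2012, Cor 3.5 (ii) p.95]. Claim key DISPUTED (D-0012). PROOF-ONLY companion (abc-iut cell, layer L6, seat
abc-iut-w4-d004 gen 4; nodes **IUTchII:Cor3.5(ii)** (Galois clause, `∞`-level), **IUTchII:Rmk3.6.1**; finding F-w4d004-g4-1 /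
GAP-LEDGER G-w4d004-1). NO definition, NO `Prop` fact, NO instance.

WHAT CHANGES (cf. `…GenuineRecordRestrictionIsoAct`, p445588). The label-wise generic theorems of this node
(`restriction_conj_section_eq_labelwise`, `mrange_pi_diagonalStable'_ofKummerHom_labelwise`,
`restrictionIso'_equivariant_ofKummerHom_labelwise`, `pi_restriction_inftyThetaMonoid_upToTorsion_ofKummerHom_labelwise`) and
their genuine-record instances (`…_toRecord_of_mem_thetaEnv`, p434664 / p434744) pin the restriction of label `t` to
`h1LimCongr (hφ t) ∘ (s_t)^*` with `hφ : ∀ t, φ ∘ j ∘ s_t = φ₀` — an equality of HOMOMORPHISMS that print's configuration with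
≥ 2 distinct labels cannot meet. HERE the restriction is pinned to the action-level pull-back
`R_t := h1LimComapAct φ A (j ∘ s_t) … φ₀ (hφAct t)` under
`hφAct : ∀ t g (a : A), conj(φ(j(s_t g))) a = conj(φ₀ g) a` (equality of ACTIONS on the cyclotome; it HOLDS at the genuine data,
`EtaleLevels.hφAct_of_aug_eq`). The equivariance `hr` is then abc-iut-w4-d004's `h1LimComapAct_conj` (p444771) and every
downstream proof is unchanged:
* §1 `restriction_conj_section_eq_labelwise_act` (`hr` derived); `mrange_pi_diagonalStable'_ofKummerHom_labelwise_act`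
  (Galois clause), `restrictionIso'_equivariant_ofKummerHom_labelwise_act` (Rmk 3.6.1),
  `pi_restriction_inftyThetaMonoid_upToTorsion_ofKummerHom_labelwise_act` (`∞`-level, faithful torsion form);
* §2 at the genuine `θ_env` data of `X̲̲_K`, ANY inversion family `iota`:
  `EtaleLevels.mrange_pi_diagonalStable'_toRecord_act_of_mem_thetaEnv`,
  `EtaleLevels.restrictionIso'_equivariant_toRecord_act_of_mem_thetaEnv`,
  `EtaleLevels.pi_restriction_inftyThetaMonoid_upToTorsion_toRecord_act_of_mem_thetaEnv`.
Nothing here asserts a disputed claim or takes a side on [IUTchIII] Cor 3.12; typed ≠ proved ≠ endorsed.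
-/

noncomputable section

namespace Literature.IUT.HodgeArakelov

universe u v w

namespace BadPrimeGaussianMonoids

open Literature.AnabelianGeometry.EtaleTheta CohomologySystemOfContH1 TemperedThetaMonoids

/-! ### §1. Label-wise: `hr` from `h1LimComapAct_conj`, then the Galois clause, Rmk 3.6.1 and the `∞`-level -/

section TransportAct

variable {Q : Type u} [Group Q] (E : TemperedThetaMonoids.ThetaEnvData.{u, v} Q)
  {P₀ P : TopGroup.{u}} {G' : Type u} [Group G'] [TopologicalSpace G'] [IsTopologicalGroup G']
  (φ : P →* G') (φ₀ : P₀ →* G') (A : Subgroup G') [A.Normal] [IsMulCommutative A] (N : Subgroup P) [N.Normal]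
  (j : Q →* P) (ψ : Additive E.H ≃+ h1Lim φ A N ⊥) {L : Type*} (s : L → (P₀ →* Q))

/-- **IUTchII:Cor3.5(ii)** `hr` DERIVED, label-wise, over the ACTION-LEVEL junction: restriction morphisms `R_t` pinned to
`h1LimComapAct φ A (j ∘ s_t) φ₀ ∘ ψ` are equivariant along the sections `s_t` for the labeled `G_v`-action
`h1LimConjMulAut φ₀` (abc-iut-w4-d004 `h1LimComapAct_conj`). [cite: Mochizuki2012, Cor 3.5 (ii) p.95] -/
theorem restriction_conj_section_eq_labelwise_act (hι : ∀ t, Continuous (j.comp (s t)))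
    (hN : ∀ t, (⊤ : Subgroup P₀).map (j.comp (s t)) ≤ N)
    (hφAct : ∀ (t : L) (g : P₀) (a : A), MulAut.conjNormal (φ (j.comp (s t) g)) a = MulAut.conjNormal (φ₀ g) a)
    (hψ : ∀ (p : Q) (y : E.H), ψ (Additive.ofMul (E.conj p y)) = h1LimConj φ A N (j p) (ψ (Additive.ofMul y)))
    (R : L → (E.H →* Multiplicative (h1Lim φ₀ A (⊤ : Subgroup P₀) ⊥)))
    (hR : ∀ t y, Multiplicative.toAdd (R t y) =
      h1LimComapAct φ A (j.comp (s t)) (hι t) φ₀ (hφAct t) (hN t) (ψ (Additive.ofMul y)))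
    (t : L) (g : P₀) (y : E.H) :
    R t (E.conj (s t g) y) = h1LimConjMulAut φ₀ A ⊤ g (R t y) := by
  apply Multiplicative.toAdd.injective
  rw [h1LimConjMulAut_apply, toAdd_ofAdd, hR, hR, hψ]
  exact h1LimComapAct_conj φ A (j.comp (s t)) (hι t) φ₀ (hφAct t) (hN t) g _

end TransportAct

section LabelwiseAct

variable {Q : Type u} [Group Q] (E : TemperedThetaMonoids.ThetaEnvData.{u, v} Q)
  {A : Type w} [CommGroup A] (ρ : Q →* MulAut A) (O : Submonoid A)
  (hO : ∀ (σ : Q) (b : A), b ∈ O → ρ σ b ∈ O) (κ : O →* E.H)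
  {P₀ P : TopGroup.{u}} {G' : Type u} [Group G'] [TopologicalSpace G'] [IsTopologicalGroup G']
  (φ : P →* G') (φ₀ : P₀ →* G') (Am : Subgroup G') [Am.Normal] [IsMulCommutative Am] (N : Subgroup P) [N.Normal]
  (j : Q →* P) (ψ : Additive E.H ≃+ h1Lim φ Am N ⊥) {L : Type*} (s : L → (P₀ →* Q))
  (hι : ∀ t, Continuous (j.comp (s t))) (hN : ∀ t, (⊤ : Subgroup P₀).map (j.comp (s t)) ≤ N)
  (hφAct : ∀ (t : L) (g : P₀) (a : Am), MulAut.conjNormal (φ (j.comp (s t) g)) a = MulAut.conjNormal (φ₀ g) a)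

/-- **IUTchII:Cor3.5(ii)** (kurims p.95), the Galois clause at the LABEL-WISE cohomology model from the Kummer map of a
module of constants with EXPLICIT action `ρ`, restrictions pinned to the ACTION-LEVEL pull-back `h1LimComapAct` — `hr`,
`hfix` discharged, `hs` from "sections of an augmentation whose kernel acts trivially on `O`".
[cite: Mochizuki2012, Cor 3.5 (ii) p.95] -/
theorem mrange_pi_diagonalStable'_ofKummerHom_labelwise_act (hcns : E.constantMonoid = MonoidHom.mrange κ)
    (hκeq : ∀ (σ : Q) (m : O), κ ⟨ρ σ (m : A), hO σ m m.2⟩ = E.conj σ (κ m))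
    {K : Type*} [Group K] (q : Q →* K) (hq : ∀ x : Q, q x = 1 → ∀ a ∈ O, ρ x a = a) (w : P₀ →* K)
    (hsec : ∀ t g, q (s t g) = w g)
    (hψ : ∀ (p : Q) (y : E.H),
      ψ (Additive.ofMul (E.conj p y)) = h1LimConj φ Am N (j p) (ψ (Additive.ofMul y)))
    (θ : E.H) (hθ : ψ (Additive.ofMul θ) ∈ Set.range ((cohomologySystemOfContH1 φ Am N).toLim ⊤))
    (R : L → (E.H →* Multiplicative (h1Lim φ₀ Am (⊤ : Subgroup P₀) ⊥)))
    (hR : ∀ t y, Multiplicative.toAdd (R t y) =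
      h1LimComapAct φ Am (j.comp (s t)) (hι t) φ₀ (hφAct t) (hN t) (ψ (Additive.ofMul y)))
    (t₀ : L) (g : P₀) :
    (MonoidHom.mrange (MonoidHom.pi fun t =>
        (R t).comp (splitMonoid E.units (Submonoid.powers θ)).subtype)).map
        (piIso L (h1LimConjMulAut φ₀ Am ⊤ g)).toMonoidHom =
      MonoidHom.mrange (MonoidHom.pi fun t => (R t).comp (splitMonoid E.units (Submonoid.powers θ)).subtype) := by
  have hfix : ∀ g t, E.conj (s t g) θ = θ := conj_section_eq_self_labelwise E φ Am N j ψ s hN hψ hθ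
  have hstab := thetaSplit_conjStable_ofKummerHom E ρ O hO κ hcns hκeq s θ hfix
  exact mrange_pi_diagonalStable_submonoid E.conj s (h1LimConjMulAut φ₀ Am ⊤) _ hstab _
    (fun t g' x => restriction_conj_section_eq_labelwise_act E φ φ₀ Am N j ψ s hι hN hφAct hψ R hR t g' (x : E.H))
    (sync_splitMonoid E.conj s E.units θ
      (sync_units_of_sections_kummerHom E ρ O hO κ hcns hκeq q.ker
        (fun δ hδ a ha => hq δ (MonoidHom.mem_ker.mp hδ) a ha) s
        (sections_mk_eq_of_isSection s q q.ker (fun x hx => MonoidHom.mem_ker.mpr hx) w hsec))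
      (fun g t t' => by rw [hfix, hfix])) t₀ g

/-- **IUTchII:Rmk3.6.1** (kurims p.101) at the label-wise Kummer-hom model, restrictions pinned to the ACTION-LEVEL pull-back:
any monoid isomorphism `e` out of `M^×_TM · θ^ℕ` which is the product restriction `∏_t R_t` on elements is
`G_v,⟨F_l^⋇⟩`-EQUIVARIANT (diagonal action) — `hstab`, `hr`, `hsync` derived. [cite: Mochizuki2012, Rmk 3.6.1 p.101] -/
theorem restrictionIso'_equivariant_ofKummerHom_labelwise_act (hcns : E.constantMonoid = MonoidHom.mrange κ)
    (hκeq : ∀ (σ : Q) (m : O), κ ⟨ρ σ (m : A), hO σ m m.2⟩ = E.conj σ (κ m))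
    {K : Type*} [Group K] (q : Q →* K) (hq : ∀ x : Q, q x = 1 → ∀ a ∈ O, ρ x a = a) (w : P₀ →* K)
    (hsec : ∀ t g, q (s t g) = w g)
    (hψ : ∀ (p : Q) (y : E.H),
      ψ (Additive.ofMul (E.conj p y)) = h1LimConj φ Am N (j p) (ψ (Additive.ofMul y)))
    (θ : E.H) (hθ : ψ (Additive.ofMul θ) ∈ Set.range ((cohomologySystemOfContH1 φ Am N).toLim ⊤))
    (R : L → (E.H →* Multiplicative (h1Lim φ₀ Am (⊤ : Subgroup P₀) ⊥)))
    (hR : ∀ t y, Multiplicative.toAdd (R t y) =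
      h1LimComapAct φ Am (j.comp (s t)) (hι t) φ₀ (hφAct t) (hN t) (ψ (Additive.ofMul y)))
    {S' : Submonoid (L → Multiplicative (h1Lim φ₀ Am (⊤ : Subgroup P₀) ⊥))}
    (e : splitMonoid E.units (Submonoid.powers θ) ≃* S')
    (he : ∀ x : splitMonoid E.units (Submonoid.powers θ), ((e x : S') : L → _) =
      MonoidHom.pi (fun t => (R t).comp (splitMonoid E.units (Submonoid.powers θ)).subtype) x)
    (t₀ : L) (g : P₀) (x : splitMonoid E.units (Submonoid.powers θ))
    (hx : E.conj (s t₀ g) (x : E.H) ∈ splitMonoid E.units (Submonoid.powers θ)) :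
    ((e ⟨E.conj (s t₀ g) (x : E.H), hx⟩ : S') : L → _) = piIso L (h1LimConjMulAut φ₀ Am ⊤ g) (e x : L → _) :=
  restrictionIso'_equivariant E.conj s (h1LimConjMulAut φ₀ Am ⊤) (splitMonoid E.units (Submonoid.powers θ))
    (fun t => (R t).comp (splitMonoid E.units (Submonoid.powers θ)).subtype)
    (thetaSplit_conjStable_ofKummerHom E ρ O hO κ hcns hκeq s θ
      (conj_section_eq_self_labelwise E φ Am N j ψ s hN hψ hθ))
    (fun t g' y => restriction_conj_section_eq_labelwise_act E φ φ₀ Am N j ψ s hι hN hφAct hψ R hR t g' (y : E.H))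
    (sync_thetaSplit_ofKummerHom_labelwise E ρ O hO κ φ Am N j ψ s hN hcns hκeq q hq w hsec hψ θ hθ) e he t₀ g x

/-- **IUTchII:Cor3.5(ii)** (kurims p.95) at `∞Ψ^ι_env(M^Θ_*) = M^×_TM · ⟨∞θ^ι_env⟩`, FAITHFUL (torsion) form, at the
label-wise Kummer-hom model with restrictions pinned to the ACTION-LEVEL pull-back: for `x ∈ ∞Ψ^ι_env` the product restriction
of `s_{t₀}(g)·x` is the DIAGONAL translate of the product restriction of `x` up to a family of `N`-torsion classes, `N > 0`
with `x^N ∈ M^×_TM · θ^ℕ` — given print's root condition `hroots`. [cite: Mochizuki2012, Cor 3.5 (ii) p.95] -/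
theorem pi_restriction_inftyThetaMonoid_upToTorsion_ofKummerHom_labelwise_act
    (hcns : E.constantMonoid = MonoidHom.mrange κ)
    (hκeq : ∀ (σ : Q) (m : O), κ ⟨ρ σ (m : A), hO σ m m.2⟩ = E.conj σ (κ m))
    {K : Type*} [Group K] (q : Q →* K) (hq : ∀ x : Q, q x = 1 → ∀ a ∈ O, ρ x a = a) (w : P₀ →* K)
    (hsec : ∀ t g, q (s t g) = w g)
    (hψ : ∀ (p : Q) (y : E.H),
      ψ (Additive.ofMul (E.conj p y)) = h1LimConj φ Am N (j p) (ψ (Additive.ofMul y)))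
    (ι : E.Iota) (θ : E.H) (hθ : ψ (Additive.ofMul θ) ∈ Set.range ((cohomologySystemOfContH1 φ Am N).toLim ⊤))
    (hroots : ∀ ϑ ∈ E.inftyThetaEnv ι, ∃ N : ℕ, 0 < N ∧ ϑ ^ N ∈ splitMonoid E.units (Submonoid.powers θ))
    (R : L → (E.H →* Multiplicative (h1Lim φ₀ Am (⊤ : Subgroup P₀) ⊥)))
    (hR : ∀ t y, Multiplicative.toAdd (R t y) =
      h1LimComapAct φ Am (j.comp (s t)) (hι t) φ₀ (hφAct t) (hN t) (ψ (Additive.ofMul y)))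
    {x : E.H} (hx : x ∈ E.inftyThetaMonoid ι) (t₀ : L) (g : P₀) :
    ∃ (n : ℕ) (u : L → E.H), 0 < n ∧ (∀ t, u t ^ n = 1) ∧
      MonoidHom.pi R (E.conj (s t₀ g) x) =
        (fun t => R t (u t)) * piIso L (h1LimConjMulAut φ₀ Am ⊤ g) (MonoidHom.pi R x) := by
  obtain ⟨n, hn, hxn⟩ := exists_pow_mem_of_mem_splitMonoid_closure E.units (E.inftyThetaEnv ι)
    (splitMonoid E.units (Submonoid.powers θ))
    (fun u hu => (mem_splitMonoid_iff _ _ _).mpr ⟨u, hu, 1, Submonoid.one_mem _, mul_one u⟩) hroots x hx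
  obtain ⟨u, hu, h⟩ := pi_conj_eq_mul_piIso_upToTorsion E.conj s (h1LimConjMulAut φ₀ Am ⊤) R
    (fun t g' y => restriction_conj_section_eq_labelwise_act E φ φ₀ Am N j ψ s hι hN hφAct hψ R hR t g' y)
    (splitMonoid E.units (Submonoid.powers θ))
    (sync_thetaSplit_ofKummerHom_labelwise E ρ O hO κ φ Am N j ψ s hN hcns hκeq q hq w hsec hψ θ hθ) hxn t₀ g
  exact ⟨n, u, hn, hu, h⟩

end LabelwiseAct

end BadPrimeGaussianMonoids

/-! ### §2. At the genuine `θ_env` data of `X̲̲_K`, ANY inversion family `iota` -/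

namespace EtaleLevels

open Literature.AnabelianGeometry.EtaleTheta CohomologySystemOfContH1 EtaleThetaDataOfSetting TemperedThetaMonoids
  BadPrimeGaussianMonoids

variable {p : ℕ} [Fact p.Prime] {D : Literature.AnabelianGeometry.EtaleTheta.ThetaSetting p}
  {E : D.EtaleThetaData} {l : ℕ} (C : E.DoubleUnderline l) (hC : D.Compat) (hS : D.Sec2Hyps)
  (hl : l.Prime) (hp2 : p ≠ 2) (hpl : p ≠ l) (hζ : ∃ ζ : D.K, IsPrimitiveRoot ζ (4 * l))
  (mods : ∀ M : ℕ+, D.CyclotomeMod l M)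
  (f : contCocycles D.toTheta D.DeltaTheta C.GtpYdduu) (hf : f ∈ C.rootCocycles hC)
  (hmods : ∀ (M M' : ℕ+) (h : (M : ℕ) ∣ (M' : ℕ)) (x : D.lDeltaTheta l),
    MuN.red p M M' h ((mods M').red x) = (mods M).red x)
  (h15 : Literature.AnabelianGeometry.EtaleTheta.ThetaSetting.Prop15iii E hC) (L : C.CuspLabels)
  (hZ : ∀ M : ℕ+, Nonempty (ModelCyclotomes.lDeltaQuot (C.rigidData (mods M) hC hS h15 L) ≃*
    Literature.IUT.HodgeTheaters.ZHat))
  (hcharY : EtaleThetaDataOfSetting.PiYddCharacteristic C)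
  (hlim : Function.Bijective (rigidLimHom C hC hS hl hp2 hpl hζ mods f hf hmods h15 L hZ))
  [(EtaleThetaDataOfSetting.PiYdd C).Normal]
  {A : Type} [CommGroup A] [MulDistribMulAction (Pi C) A] [TopologicalSpace A] [RootableBy A ℕ]
  (c : CyclotomeCoefficients (phi C) (D.lDeltaTheta l) A)
  (hA : ∀ b : A, IsOpen (MulAction.stabilizer (Pi C) b : Set (Pi C)))
  (hfi : ∀ b : A, (MulAction.stabilizer (Pi C) b).FiniteIndex)
  (O : Submonoid A) (hO : ∀ (σ : Pi C) (b : A), b ∈ O → σ • b ∈ O)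
  {Iota : Type}
  (iota : Iota → ((thetaEnvData C hC hS hl hp2 hpl hζ mods f hf hmods h15 L hZ hcharY hlim).D.coh.lim ≃+
    (thetaEnvData C hC hS hl hp2 hpl hζ mods f hf hmods h15 L hZ hcharY hlim).D.coh.lim))
  {Lbl : Type*} {P₀ : TopGroup.{0}} (φ₀ : P₀ →* D.GtpTheta) (s : Lbl → (P₀ →* Pi C))
  (hι : ∀ t, Continuous ((MonoidHom.id (Pi C)).comp (s t)))
  (hN : ∀ t, (⊤ : Subgroup P₀).map ((MonoidHom.id (Pi C)).comp (s t)) ≤ PiYdd C)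
  -- THE ACTION-LEVEL JUNCTION (replaces `hφ : ∀ t, (phi C).comp (s t) = φ₀`)
  (hφAct : ∀ (t : Lbl) (g : P₀) (a : D.lDeltaTheta l),
    MulAut.conjNormal (phi C (((MonoidHom.id (Pi C)).comp (s t)) g)) a = MulAut.conjNormal (φ₀ g) a)

include hO in
/-- **IUTchII:Cor3.5(ii)** (kurims p.95) "each `Ψ_ξ(M^Θ_*)` is equipped with a natural action by `G_v(M^Θ_*▶)_{⟨F_l^⋇⟩}`"
**AT THE GENUINE `θ_env` DATA, ANY inversion family `iota`, ACTION-LEVEL junction**: for EVERY `θ ∈ θ^ι_env(𝕄_*)` of the record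
the Gaussian monoid `Ψ_ξ = r(M^×_TM · θ^ℕ)` is stable under the diagonal labeled `G_v`-action — inputs = the DATA of the label-wise
evaluation sections (`s_t` continuous into `Π^tp_{Ÿ̲̲}`, coefficient actions agreeing with `φ₀` on `l·Δ_Θ`, sections of an
augmentation `q` whose kernel acts trivially on `𝒪^▷`, restrictions pinned to `h1LimComapAct ∘ s_t`) and of the model (`c`, `O`,
`hO`). [cite: Mochizuki2012, Cor 3.5 (ii) p.95] -/
theorem mrange_pi_diagonalStable'_toRecord_act_of_mem_thetaEnv
    {K : Type*} [Group K] (q : Pi C →* K) (hq : ∀ x : Pi C, q x = 1 → ∀ a ∈ O, x • a = a) (w : P₀ →* K)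
    (hsec : ∀ t g, q (s t g) = w g) {i₀ : Iota}
    {θ : ((thetaEnvData C hC hS hl hp2 hpl hζ mods f hf hmods h15 L hZ hcharY hlim).toRecord
        (h1LimConjMulAut (phi C) (D.lDeltaTheta l) (PiYdd C)) (h1LimKummerOn (phi C) (D.lDeltaTheta l) (PiYdd C) c hA hfi O)
        iota).H}
    (hθ : θ ∈ ((thetaEnvData C hC hS hl hp2 hpl hζ mods f hf hmods h15 L hZ hcharY hlim).toRecord
        (h1LimConjMulAut (phi C) (D.lDeltaTheta l) (PiYdd C)) (h1LimKummerOn (phi C) (D.lDeltaTheta l) (PiYdd C) c hA hfi O)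
        iota).thetaEnv i₀)
    (R : Lbl → (((thetaEnvData C hC hS hl hp2 hpl hζ mods f hf hmods h15 L hZ hcharY hlim).toRecord
        (h1LimConjMulAut (phi C) (D.lDeltaTheta l) (PiYdd C)) (h1LimKummerOn (phi C) (D.lDeltaTheta l) (PiYdd C) c hA hfi O)
        iota).H →*
      Multiplicative (h1Lim φ₀ (D.lDeltaTheta l) (⊤ : Subgroup P₀) ⊥)))
    (hR : ∀ t y, Multiplicative.toAdd (R t y) =
      h1LimComapAct (phi C) (D.lDeltaTheta l) ((MonoidHom.id (Pi C)).comp (s t)) (hι t) φ₀ (hφAct t) (hN t)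
        (AddEquiv.additiveMultiplicative (h1Lim (phi C) (D.lDeltaTheta l) (PiYdd C) ⊥) (Additive.ofMul y)))
    (t₀ : Lbl) (g : P₀) :
    (MonoidHom.mrange (MonoidHom.pi fun t =>
        (R t).comp (splitMonoid
          ((thetaEnvData C hC hS hl hp2 hpl hζ mods f hf hmods h15 L hZ hcharY hlim).toRecord
        (h1LimConjMulAut (phi C) (D.lDeltaTheta l) (PiYdd C)) (h1LimKummerOn (phi C) (D.lDeltaTheta l) (PiYdd C) c hA hfi O)
        iota).units
          (Submonoid.powers θ)).subtype)).map
        (piIso Lbl (h1LimConjMulAut φ₀ (D.lDeltaTheta l) ⊤ g)).toMonoidHom =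
      MonoidHom.mrange (MonoidHom.pi fun t =>
        (R t).comp (splitMonoid
          ((thetaEnvData C hC hS hl hp2 hpl hζ mods f hf hmods h15 L hZ hcharY hlim).toRecord
        (h1LimConjMulAut (phi C) (D.lDeltaTheta l) (PiYdd C)) (h1LimKummerOn (phi C) (D.lDeltaTheta l) (PiYdd C) c hA hfi O)
        iota).units
          (Submonoid.powers θ)).subtype) :=
  mrange_pi_diagonalStable'_ofKummerHom_labelwise_act
    ((thetaEnvData C hC hS hl hp2 hpl hζ mods f hf hmods h15 L hZ hcharY hlim).toRecord
        (h1LimConjMulAut (phi C) (D.lDeltaTheta l) (PiYdd C)) (h1LimKummerOn (phi C) (D.lDeltaTheta l) (PiYdd C) c hA hfi O)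
        iota)
    (MulDistribMulAction.toMulAut (Pi C) A) O (fun σ b hb => hO σ b hb)
    (h1LimKummerOn (phi C) (D.lDeltaTheta l) (PiYdd C) c hA hfi O) (phi C) φ₀ (D.lDeltaTheta l) (PiYdd C)
    (MonoidHom.id (Pi C)) (AddEquiv.additiveMultiplicative (h1Lim (phi C) (D.lDeltaTheta l) (PiYdd C) ⊥)) s hι hN hφAct
    (ThetaEnvData.toRecord_constantMonoid _ _ _ _)
    (fun (σ : Pi C) m => h1LimKummerOn_smul (phi C) (D.lDeltaTheta l) (PiYdd C) c hA hfi O σ m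
      ⟨σ • (m : A), hO σ m m.2⟩ rfl)
    q (fun x hx a ha => hq x hx a ha) w hsec (fun _ _ => rfl) θ
    (topClass_toRecord_family C hC hS hl hp2 hpl hζ mods f hf hmods h15 L hZ hcharY hlim c hA hfi O iota hθ) R hR t₀ g

include hO in
/-- **IUTchII:Rmk3.6.1** (kurims p.101) **AT THE GENUINE `θ_env` DATA, ANY inversion family `iota`, ACTION-LEVEL junction**: for
every `θ ∈ θ^ι_env(𝕄_*)`, any restriction isomorphism `e` out of `M^×_TM · θ^ℕ` (product of the action-level restrictions on
elements) intertwines the action of `G_v` through the section `s_{t₀}` with the DIAGONAL action.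
[cite: Mochizuki2012, Rmk 3.6.1 p.101] -/
theorem restrictionIso'_equivariant_toRecord_act_of_mem_thetaEnv
    {K : Type*} [Group K] (q : Pi C →* K) (hq : ∀ x : Pi C, q x = 1 → ∀ a ∈ O, x • a = a) (w : P₀ →* K)
    (hsec : ∀ t g, q (s t g) = w g) {i₀ : Iota}
    {θ : ((thetaEnvData C hC hS hl hp2 hpl hζ mods f hf hmods h15 L hZ hcharY hlim).toRecord
        (h1LimConjMulAut (phi C) (D.lDeltaTheta l) (PiYdd C)) (h1LimKummerOn (phi C) (D.lDeltaTheta l) (PiYdd C) c hA hfi O)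
        iota).H}
    (hθ : θ ∈ ((thetaEnvData C hC hS hl hp2 hpl hζ mods f hf hmods h15 L hZ hcharY hlim).toRecord
        (h1LimConjMulAut (phi C) (D.lDeltaTheta l) (PiYdd C)) (h1LimKummerOn (phi C) (D.lDeltaTheta l) (PiYdd C) c hA hfi O)
        iota).thetaEnv i₀)
    (R : Lbl → (((thetaEnvData C hC hS hl hp2 hpl hζ mods f hf hmods h15 L hZ hcharY hlim).toRecord
        (h1LimConjMulAut (phi C) (D.lDeltaTheta l) (PiYdd C)) (h1LimKummerOn (phi C) (D.lDeltaTheta l) (PiYdd C) c hA hfi O)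
        iota).H →*
      Multiplicative (h1Lim φ₀ (D.lDeltaTheta l) (⊤ : Subgroup P₀) ⊥)))
    (hR : ∀ t y, Multiplicative.toAdd (R t y) =
      h1LimComapAct (phi C) (D.lDeltaTheta l) ((MonoidHom.id (Pi C)).comp (s t)) (hι t) φ₀ (hφAct t) (hN t)
        (AddEquiv.additiveMultiplicative (h1Lim (phi C) (D.lDeltaTheta l) (PiYdd C) ⊥) (Additive.ofMul y)))
    {S' : Submonoid (Lbl → Multiplicative (h1Lim φ₀ (D.lDeltaTheta l) (⊤ : Subgroup P₀) ⊥))}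
    (e : splitMonoid ((thetaEnvData C hC hS hl hp2 hpl hζ mods f hf hmods h15 L hZ hcharY hlim).toRecord
        (h1LimConjMulAut (phi C) (D.lDeltaTheta l) (PiYdd C)) (h1LimKummerOn (phi C) (D.lDeltaTheta l) (PiYdd C) c hA hfi O)
        iota).units
      (Submonoid.powers θ) ≃* S')
    (he : ∀ x, ((e x : S') : Lbl → _) = MonoidHom.pi (fun t => (R t).comp (splitMonoid
      ((thetaEnvData C hC hS hl hp2 hpl hζ mods f hf hmods h15 L hZ hcharY hlim).toRecord
        (h1LimConjMulAut (phi C) (D.lDeltaTheta l) (PiYdd C)) (h1LimKummerOn (phi C) (D.lDeltaTheta l) (PiYdd C) c hA hfi O)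
        iota).units
      (Submonoid.powers θ)).subtype) x)
    (t₀ : Lbl) (g : P₀)
    (x : splitMonoid ((thetaEnvData C hC hS hl hp2 hpl hζ mods f hf hmods h15 L hZ hcharY hlim).toRecord
        (h1LimConjMulAut (phi C) (D.lDeltaTheta l) (PiYdd C)) (h1LimKummerOn (phi C) (D.lDeltaTheta l) (PiYdd C) c hA hfi O)
        iota).units
      (Submonoid.powers θ))
    (hx : ((thetaEnvData C hC hS hl hp2 hpl hζ mods f hf hmods h15 L hZ hcharY hlim).toRecord
        (h1LimConjMulAut (phi C) (D.lDeltaTheta l) (PiYdd C)) (h1LimKummerOn (phi C) (D.lDeltaTheta l) (PiYdd C) c hA hfi O)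
        iota).conj (s t₀ g)
      (x : ((thetaEnvData C hC hS hl hp2 hpl hζ mods f hf hmods h15 L hZ hcharY hlim).toRecord
        (h1LimConjMulAut (phi C) (D.lDeltaTheta l) (PiYdd C)) (h1LimKummerOn (phi C) (D.lDeltaTheta l) (PiYdd C) c hA hfi O)
        iota).H) ∈
      splitMonoid ((thetaEnvData C hC hS hl hp2 hpl hζ mods f hf hmods h15 L hZ hcharY hlim).toRecord
        (h1LimConjMulAut (phi C) (D.lDeltaTheta l) (PiYdd C)) (h1LimKummerOn (phi C) (D.lDeltaTheta l) (PiYdd C) c hA hfi O)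
        iota).units
        (Submonoid.powers θ)) :
    ((e ⟨_, hx⟩ : S') : Lbl → _) = piIso Lbl (h1LimConjMulAut φ₀ (D.lDeltaTheta l) ⊤ g) (e x : Lbl → _) :=
  restrictionIso'_equivariant_ofKummerHom_labelwise_act
    ((thetaEnvData C hC hS hl hp2 hpl hζ mods f hf hmods h15 L hZ hcharY hlim).toRecord
        (h1LimConjMulAut (phi C) (D.lDeltaTheta l) (PiYdd C)) (h1LimKummerOn (phi C) (D.lDeltaTheta l) (PiYdd C) c hA hfi O)
        iota)
    (MulDistribMulAction.toMulAut (Pi C) A) O (fun σ b hb => hO σ b hb)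
    (h1LimKummerOn (phi C) (D.lDeltaTheta l) (PiYdd C) c hA hfi O) (phi C) φ₀ (D.lDeltaTheta l) (PiYdd C)
    (MonoidHom.id (Pi C)) (AddEquiv.additiveMultiplicative (h1Lim (phi C) (D.lDeltaTheta l) (PiYdd C) ⊥)) s hι hN hφAct
    (ThetaEnvData.toRecord_constantMonoid _ _ _ _)
    (fun (σ : Pi C) m => h1LimKummerOn_smul (phi C) (D.lDeltaTheta l) (PiYdd C) c hA hfi O σ m
      ⟨σ • (m : A), hO σ m m.2⟩ rfl)
    q (fun x hx a ha => hq x hx a ha) w hsec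
    (fun _ _ => rfl) θ
    (topClass_toRecord_family C hC hS hl hp2 hpl hζ mods f hf hmods h15 L hZ hcharY hlim c hA hfi O iota hθ)
    R hR e he t₀ g x hx

include hO in
/-- **IUTchII:Cor3.5(ii)** (kurims p.95) at `∞Ψ^ι_env(𝕄_*)`, FAITHFUL (torsion) form, **AT THE GENUINE `θ_env` DATA, ANY inversion
family `iota`, ACTION-LEVEL junction**: for every `θ ∈ θ^ι_env(𝕄_*)` and `x ∈ ∞Ψ^{i}_env = M^×_TM · ⟨∞θ^{i}_env⟩`, the product of
the action-level restrictions of `s_{t₀}(g)·x` is the diagonal translate of that of `x` up to a family of `n`-torsion classes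
(`n > 0`, `x^n ∈ M^×_TM · θ^ℕ`), given print's root condition `hroots` on the generators `∞θ^{i}_env` (Prop 1.4 p. 27).
[cite: Mochizuki2012, Cor 3.5 (ii) p.95] -/
theorem pi_restriction_inftyThetaMonoid_upToTorsion_toRecord_act_of_mem_thetaEnv
    {K : Type*} [Group K] (q : Pi C →* K) (hq : ∀ x : Pi C, q x = 1 → ∀ a ∈ O, x • a = a) (w : P₀ →* K)
    (hsec : ∀ t g, q (s t g) = w g) {i₀ : Iota}
    {θ : ((thetaEnvData C hC hS hl hp2 hpl hζ mods f hf hmods h15 L hZ hcharY hlim).toRecord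
        (h1LimConjMulAut (phi C) (D.lDeltaTheta l) (PiYdd C)) (h1LimKummerOn (phi C) (D.lDeltaTheta l) (PiYdd C) c hA hfi O)
        iota).H}
    (hθ : θ ∈ ((thetaEnvData C hC hS hl hp2 hpl hζ mods f hf hmods h15 L hZ hcharY hlim).toRecord
        (h1LimConjMulAut (phi C) (D.lDeltaTheta l) (PiYdd C)) (h1LimKummerOn (phi C) (D.lDeltaTheta l) (PiYdd C) c hA hfi O)
        iota).thetaEnv i₀)
    (i : ((thetaEnvData C hC hS hl hp2 hpl hζ mods f hf hmods h15 L hZ hcharY hlim).toRecord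
        (h1LimConjMulAut (phi C) (D.lDeltaTheta l) (PiYdd C)) (h1LimKummerOn (phi C) (D.lDeltaTheta l) (PiYdd C) c hA hfi O)
        iota).Iota)
    (hroots : ∀ ϑ ∈ ((thetaEnvData C hC hS hl hp2 hpl hζ mods f hf hmods h15 L hZ hcharY hlim).toRecord
        (h1LimConjMulAut (phi C) (D.lDeltaTheta l) (PiYdd C)) (h1LimKummerOn (phi C) (D.lDeltaTheta l) (PiYdd C) c hA hfi O)
        iota).inftyThetaEnv i,
      ∃ n : ℕ, 0 < n ∧ ϑ ^ n ∈
        splitMonoid ((thetaEnvData C hC hS hl hp2 hpl hζ mods f hf hmods h15 L hZ hcharY hlim).toRecord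
        (h1LimConjMulAut (phi C) (D.lDeltaTheta l) (PiYdd C)) (h1LimKummerOn (phi C) (D.lDeltaTheta l) (PiYdd C) c hA hfi O)
        iota).units
          (Submonoid.powers θ))
    (R : Lbl → (((thetaEnvData C hC hS hl hp2 hpl hζ mods f hf hmods h15 L hZ hcharY hlim).toRecord
        (h1LimConjMulAut (phi C) (D.lDeltaTheta l) (PiYdd C)) (h1LimKummerOn (phi C) (D.lDeltaTheta l) (PiYdd C) c hA hfi O)
        iota).H →*
      Multiplicative (h1Lim φ₀ (D.lDeltaTheta l) (⊤ : Subgroup P₀) ⊥)))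
    (hR : ∀ t y, Multiplicative.toAdd (R t y) =
      h1LimComapAct (phi C) (D.lDeltaTheta l) ((MonoidHom.id (Pi C)).comp (s t)) (hι t) φ₀ (hφAct t) (hN t)
        (AddEquiv.additiveMultiplicative (h1Lim (phi C) (D.lDeltaTheta l) (PiYdd C) ⊥) (Additive.ofMul y)))
    {x : ((thetaEnvData C hC hS hl hp2 hpl hζ mods f hf hmods h15 L hZ hcharY hlim).toRecord
        (h1LimConjMulAut (phi C) (D.lDeltaTheta l) (PiYdd C)) (h1LimKummerOn (phi C) (D.lDeltaTheta l) (PiYdd C) c hA hfi O)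
        iota).H}
    (hx : x ∈ ((thetaEnvData C hC hS hl hp2 hpl hζ mods f hf hmods h15 L hZ hcharY hlim).toRecord
        (h1LimConjMulAut (phi C) (D.lDeltaTheta l) (PiYdd C)) (h1LimKummerOn (phi C) (D.lDeltaTheta l) (PiYdd C) c hA hfi O)
        iota).inftyThetaMonoid i)
    (t₀ : Lbl) (g : P₀) :
    ∃ (n : ℕ) (u : Lbl → ((thetaEnvData C hC hS hl hp2 hpl hζ mods f hf hmods h15 L hZ hcharY hlim).toRecord
        (h1LimConjMulAut (phi C) (D.lDeltaTheta l) (PiYdd C)) (h1LimKummerOn (phi C) (D.lDeltaTheta l) (PiYdd C) c hA hfi O)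
        iota).H),
      0 < n ∧ (∀ t, u t ^ n = 1) ∧
      MonoidHom.pi R
          (((thetaEnvData C hC hS hl hp2 hpl hζ mods f hf hmods h15 L hZ hcharY hlim).toRecord
        (h1LimConjMulAut (phi C) (D.lDeltaTheta l) (PiYdd C)) (h1LimKummerOn (phi C) (D.lDeltaTheta l) (PiYdd C) c hA hfi O)
        iota).conj (s t₀ g) x) =
        (fun t => R t (u t)) * piIso Lbl (h1LimConjMulAut φ₀ (D.lDeltaTheta l) ⊤ g) (MonoidHom.pi R x) :=
  pi_restriction_inftyThetaMonoid_upToTorsion_ofKummerHom_labelwise_act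
    ((thetaEnvData C hC hS hl hp2 hpl hζ mods f hf hmods h15 L hZ hcharY hlim).toRecord
        (h1LimConjMulAut (phi C) (D.lDeltaTheta l) (PiYdd C)) (h1LimKummerOn (phi C) (D.lDeltaTheta l) (PiYdd C) c hA hfi O)
        iota)
    (MulDistribMulAction.toMulAut (Pi C) A) O (fun σ b hb => hO σ b hb)
    (h1LimKummerOn (phi C) (D.lDeltaTheta l) (PiYdd C) c hA hfi O) (phi C) φ₀ (D.lDeltaTheta l) (PiYdd C)
    (MonoidHom.id (Pi C)) (AddEquiv.additiveMultiplicative (h1Lim (phi C) (D.lDeltaTheta l) (PiYdd C) ⊥)) s hι hN hφAct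
    (ThetaEnvData.toRecord_constantMonoid _ _ _ _)
    (fun (σ : Pi C) m => h1LimKummerOn_smul (phi C) (D.lDeltaTheta l) (PiYdd C) c hA hfi O σ m
      ⟨σ • (m : A), hO σ m m.2⟩ rfl)
    q (fun x hx a ha => hq x hx a ha) w hsec
    (fun _ _ => rfl) i θ
    (topClass_toRecord_family C hC hS hl hp2 hpl hζ mods f hf hmods h15 L hZ hcharY hlim c hA hfi O iota hθ)
    hroots R hR hx t₀ g

end EtaleLevels

end Literature.IUT.HodgeArakelov

end
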